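import Mathlib
import Summits.AtomisticToContinuum.Crystallization.Theses.PhononSlackCertificates

/-!
# Route `PhononSlackCertificates`, crux `NearFieldConvexity` (stmt-AtomisticToContinuum-13958), line `Sketch`:
stub `stub_schurStepAntitone`

Loewner antitonicity of the Schur/Riccati step (card hagg-word-riccati-barriers).

The Schur/Riccati step `X ↦ A − Bᴴ X⁻¹ B` is monotone in the Loewner order on positive definite
pivots: if `X ≻ 0` and `Y − X ⪰ 0` then `(A − Bᴴ Y⁻¹ B) − (A − Bᴴ X⁻¹ B) = Bᴴ (X⁻¹ − Y⁻¹) B ⪰ 0`.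
The engine is the Loewner antitonicity of the inverse, `schurStep_inv_antitone`
(`X ≻ 0`, `Y − X ⪰ 0 ⇒ X⁻¹ − Y⁻¹ ⪰ 0`), obtained from Mathlib's C⋆-algebra lemma
`CStarAlgebra.ringInverse_le_ringInverse` for the (scoped) L²-operator-norm C⋆-structure on
complex matrices, followed by congruence (`Matrix.PosSemidef.conjTranspose_mul_mul_same`).

The helpers `schurStep_*` are public and stated for a general finite index type so that sibling
files (block `fromBlocks` barriers) can reuse them.
-/

noncomputable section

open scoped BigOperators InnerProductSpace Matrix ComplexOrder
open Literature.MathematicalPhysics.StatisticalMechanics Literature.Geometry.DiscreteGeometry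

namespace Summit.AtomisticToContinuum.Crystallization.Theorems.PhononSlackNearFieldConvexity

section SchurStepHelpers

open scoped MatrixOrder Matrix.Norms.L2Operator

/-- `Y ⪰ X ≻ 0 ⇒ Y ≻ 0`: a Loewner upper bound of a positive definite matrix is positive
definite. -/
theorem schurStep_posDef_of_sub_posSemidef {n : Type*} [Fintype n] {X Y : Matrix n n ℂ}
    (hX : X.PosDef) (hXY : (Y - X).PosSemidef) : Y.PosDef := by
  simpa only [add_sub_cancel] using hX.add_posSemidef hXY

/-- **Loewner antitonicity of the inverse.** If `X ≻ 0` and `Y - X ⪰ 0` then `X⁻¹ - Y⁻¹ ⪰ 0`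
(here `⁻¹` is `Matrix.inv`, the nonsingular inverse; `Y` is automatically positive definite). -/
theorem schurStep_inv_antitone {n : Type*} [Fintype n] [DecidableEq n] {X Y : Matrix n n ℂ}
    (hX : X.PosDef) (hXY : (Y - X).PosSemidef) : (X⁻¹ - Y⁻¹).PosSemidef := by
  letI : CStarAlgebra (Matrix n n ℂ) := {}
  have hle : X ≤ Y := Matrix.le_iff.mpr hXY
  have h : Y⁻¹ ≤ X⁻¹ := by
    rw [Matrix.nonsing_inv_eq_ringInverse, Matrix.nonsing_inv_eq_ringInverse]
    exact CStarAlgebra.ringInverse_le_ringInverse hle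
      (Matrix.isStrictlyPositive_iff_posDef.mpr hX)
  exact Matrix.le_iff.mp h

/-- **Loewner monotonicity of the inverse pivot, conjugated.** If `X ≻ 0` and `Y - X ⪰ 0` then
`Bᴴ (X⁻¹ - Y⁻¹) B ⪰ 0` for every (rectangular) `B`. -/
theorem schurStep_conj_inv_antitone {n m : Type*} [Fintype n] [DecidableEq n] [Finite m]
    {X Y : Matrix n n ℂ} (hX : X.PosDef) (hXY : (Y - X).PosSemidef) (B : Matrix n m ℂ) :
    (Bᴴ * (X⁻¹ - Y⁻¹) * B).PosSemidef :=
  (schurStep_inv_antitone hX hXY).conjTranspose_mul_mul_same B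

/-- Ring algebra of the Schur step: the difference of two Schur steps with the same `A`, `B` is the
congruence of the difference of the pivots, `(A - Bᴴ P B) - (A - Bᴴ Q B) = Bᴴ (Q - P) B`. -/
theorem schurStep_sub_schurStep {n m : Type*} [Fintype n] (A : Matrix m m ℂ) (B : Matrix n m ℂ)
    (P Q : Matrix n n ℂ) : (A - Bᴴ * P * B) - (A - Bᴴ * Q * B) = Bᴴ * (Q - P) * B := by
  rw [Matrix.mul_sub, Matrix.sub_mul]
  abel

end SchurStepHelpers

/-- **Stub (card B): the Schur/Riccati step `X ↦ A − Bᴴ X⁻¹ B` is monotone in the Loewner order on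
positive definite pivots** (`Y ⪰ X ≻ 0 ⇒ Y ≻ 0` is automatic, so only `X ≻ 0` is assumed). -/
theorem stub_schurStepAntitone {m k : ℕ} (A : Matrix (Fin m) (Fin m) ℂ) (B : Matrix (Fin k) (Fin m) ℂ)
    (X Y : Matrix (Fin k) (Fin k) ℂ) (hX : X.PosDef) (hXY : (Y - X).PosSemidef) :
    ((A - Bᴴ * Y⁻¹ * B) - (A - Bᴴ * X⁻¹ * B)).PosSemidef := by
  rw [schurStep_sub_schurStep]
  exact schurStep_conj_inv_antitone hX hXY B

end Summit.AtomisticToContinuum.Crystallization.Theorems.PhononSlackNearFieldConvexity
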